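import Literature.Computability.AlgebraicComplexity.GlobalStageStructure
import HarnessLib

/-!
# The holes of the copies of `𝒯*`: Claim 5.16, Markov's inequality and the existence of a good seed
(Vassilevska Williams–Xu–Xu–Zhou 2024, §5.6) — proved

Topic `Literature/Computability/AlgebraicComplexity`.  §5.6 of Vassilevska Williams–Xu–Xu–Zhou
(SODA 2024, arXiv:2307.07970) bounds the holes of the broken copies `𝒯'''|_{X_I Y_J Z_K}` of `𝒯*`
(`GlobalStageStructure.lean`: `holes ω T`, the level-1 `Z`-blocks useful for the present triple `T`
but compatible with another present triple through `Z_K`):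

> **Claim 5.16.** For every `b ∈ B`, every level-`ℓ` block triple `X_I Y_J Z_K` consistent with `α`,
> and for each typical `Z_K̂ ∈ Z_K`, the probability that `Z_K̂` is compatible with multiple triples in
> `𝒯''` is at most `numalpha · p_comp / (numzblock · M₀)`, conditioned on `h_X(I) = h_Y(J) = h_Z(K) = b`.
> [Proof: the triples `X_{I'} Y_{J'} Z_K` compatible with `Z_K̂` other than `X_I Y_J Z_K` each land in
> bucket `b` with probability `1/M` (Claim 5.5); union bound.] … we add another (and final)
> constraint `M₀ ≥ (numalpha · p_comp / numzblock) · 80N` … by Claim 5.16, linearity of expectation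
> and Markov's inequality, among `Z_K̂ ∈ Z_K` that is useful for `X_I Y_J Z_K`, the fraction of `Z_K̂`
> that becomes a hole in `𝒯'''` is at most `10/80N = 1/8N` with probability at least `9/10`.
> Therefore, by the union bound, with constant probability, the subtensor of `𝒯'''` over
> `X_I, Y_J, Z_K` is a copy of `𝒯*` whose fraction of holes does not exceed `1/8N`.

This file PROVES these statements as exact counts over the seed space `Ω = VxxzSeed M n`
(`|Ω| = M^{n+2}`), for the data `D : GlobalStageData c n M` of one region (well-formed, `B` without
3-term progressions, `M` an odd prime `> 2c`):

* `hole_subset` — a hole of the copy over `T` in bucket `b` witnesses a triple `T' ∈ 𝒯α`, `T' ≠ T`,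
  through `Z_K`, compatible with `K̂`, in the SAME bucket `b`;
* `sum_card_holes_le` — **Claim 5.16 summed** ("linearity of expectation"): over the `M^n` seeds
  putting `T` into bucket `b`, `∑_ω |holes_ω T| ≤ U(T) · M^{n-1}`, where
  `U(T) = #{(K̂, T') | K̂ useful for T, T' ∈ 𝒯α ∖ {T} through Z_K compatible with K̂}` (`holePairs`;
  the printed `(numalpha/numzblock) · p_comp` per `K̂`);
* `card_seeds_manyHoles_le` — **Markov**: at most `U(T) M^{n-1} / h` of these seeds give more than
  `h` holes;
* `card_seeds_good_ge` — with Claim 5.6 (`vxxz2024_claim56`): if `10 · U(T) · M^{n-1} ≤ h · M^n`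
  (the final constraint on `M₀`, with `h = M_Z/(8N)`), then at least HALF of the `M^n` seeds let `T`
  be present with at most `h` holes (`3/4 − 1/10 ≥ 1/2`; the paper's "constant probability");
* `exists_seed_many_good_copies` — summing over `B × 𝒯α` and averaging: **some seed `ω` makes at
  least `|B| · |𝒯α| / (2M²)` triples present with at most `h` holes each** — the
  "`numalpha · M^{-1-o(1)}` copies of `𝒯*` whose fraction of holes is `1/8N`" of §5.6, in exact form.

Everything is proved; one definition (`holePairs`); no named facts.

## References

* V. Vassilevska Williams, Y. Xu, Z. Xu, R. Zhou, *New bounds for matrix multiplication: from alpha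
  to omega*, SODA 2024, arXiv:2307.07970 (held: `paper:arxiv-2307.07970`), §5.6: Claim 5.16 and its
  proof, the final constraint on `M₀`, the Markov/union-bound paragraph. [VassilevskaWilliamsXuXuZhou2024]
-/

noncomputable section

open scoped BigOperators
open Finset

namespace Literature.Computability.AlgebraicComplexity

namespace GlobalStageData

open scoped Classical

variable {c n M : ℕ} (D : GlobalStageData c n M)

/-- **The pairs `(K̂, T')` behind the holes of the copy over `T`**: `K̂ ∈ Z_K` useful for `T`, and a
triple `T' ∈ 𝒯α` other than `T` through the same `Z_K` with which `K̂` is compatible.  Their number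
`U(T)` is the printed `∑_{K̂ useful} (numalpha/numzblock) p_comp` (Claim 5.16: "the total number of
level-`ℓ` block triples `X_{I'} Y_{J'} Z_K` that is compatible with `Z_K̂` is `(numalpha/numzblock) p_comp`").
[cite: VassilevskaWilliamsXuXuZhou2024, Claim 5.16 (proof)] -/
def holePairs (T : (Fin n → Fin (2 * c + 1)) × (Fin n → Fin (2 * c + 1)) × (Fin n → Fin (2 * c + 1))) :
    Finset ((Fin n → Fin c → Fin 3) × ((Fin n → Fin (2 * c + 1)) × (Fin n → Fin (2 * c + 1)) × (Fin n → Fin (2 * c + 1)))) :=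
  (univ ×ˢ D.𝒯α).filter fun p => blockOfSeq p.1 = T.2.2 ∧ D.UsefulZ T p.1 ∧ p.2 ≠ T ∧ p.2.2.2 = T.2.2 ∧
    D.Compatible p.2 p.1

variable {D} [Fact M.Prime]

/-- **A hole witnesses a compatible triple in the same bucket**: if `K̂` is a hole of the copy over the
present triple `T` (seed `ω`), then some `T' ∈ 𝒯α`, `T' ≠ T`, through `Z_K`, compatible with `K̂`,
lies in the bucket `h_X(I)` of `T` (present triples are hash-present, hence in one bucket, and share
`Z_K`). [cite: VassilevskaWilliamsXuXuZhou2024, Claim 5.16 (proof: "if none of them are mapped to the same bucket … then Z_K̂ is compatible with a unique triple")] -/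
theorem hole_subset (hM : M ≠ 2) (hB : ThreeAPFree (D.B : Set (ZMod M))) {ω : VxxzSeed M n}
    {T : (Fin n → Fin (2 * c + 1)) × (Fin n → Fin (2 * c + 1)) × (Fin n → Fin (2 * c + 1))}
    (hT : T ∈ D.present ω) {Kh : Fin n → Fin c → Fin 3} (hK : Kh ∈ D.holes ω T) :
    ∃ T', (Kh, T') ∈ D.holePairs T ∧ InBucket (2 * c) ω T' (vxxzHashX ω (seqVal T.1)) := by
  rw [holes, mem_filter] at hK
  obtain ⟨-, hblk, hu, T', hT'p, hne, hK', hc⟩ := hK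
  refine ⟨T', mem_filter.2 ⟨mem_product.2 ⟨mem_univ _, presentTriples_subset hT'p⟩, hblk, hu, hne, hK', hc⟩, ?_⟩
  have hTb := inBucket_of_mem_hashPresent hM hB (hashPresent_of_mem_presentTriples hT)
  have hT'b := inBucket_of_mem_hashPresent hM hB (hashPresent_of_mem_presentTriples hT'p)
  have e : vxxzHashX ω (seqVal T'.1) = vxxzHashX ω (seqVal T.1) := by
    rw [← hT'b.2.2, ← hTb.2.2, hK']
  rwa [e] at hT'b

/-- Seeds putting two different triples of `𝒯` through the same `Z_K` into bucket `b`: `M^{n-1}`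
(Claim 5.5, `Z`-sharing). [cite: VassilevskaWilliamsXuXuZhou2024, Claim 5.5] -/
theorem card_seeds_inBucket_shareZ (hM : M ≠ 2) (hcM : 2 * c < M) (hn : 0 < n)
    {T T' : (Fin n → Fin (2 * c + 1)) × (Fin n → Fin (2 * c + 1)) × (Fin n → Fin (2 * c + 1))}
    (hT : T ∈ D.tripleSet) (hT' : T' ∈ D.tripleSet) (hne : T' ≠ T) (h3 : T'.2.2 = T.2.2) (b : ZMod M) :
    (univ.filter fun ω : VxxzSeed M n => InBucket (2 * c) ω T b ∧ InBucket (2 * c) ω T' b).card = M ^ (n - 1) := by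
  have hIJ : (seqVal T.1, seqVal T.2.1) ≠ (seqVal T'.1, seqVal T'.2.1) := by
    intro h
    simp only [Prod.mk.injEq] at h
    apply hne
    have h1 : T'.1 = T.1 := funext fun t => Fin.ext (congrFun h.1 t).symm
    have h2 : T'.2.1 = T.2.1 := funext fun t => Fin.ext (congrFun h.2 t).symm
    exact Prod.ext h1 (Prod.ext h2 h3)
  have h := card_seeds_vxxzHash_bucket_shareZ (n := n) hM (levelSum_of_mem_typedSupport hT)
    (I' := seqVal T'.1) (J' := seqVal T'.2.1)
    (by intro t; have := levelSum_of_mem_typedSupport hT' t; rw [h3] at this; exact this)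
    (seqVal_lt hcM _) (seqVal_lt hcM _) hIJ b
  have hM3 : 0 < M ^ 3 := pow_pos (Nat.Prime.pos Fact.out) 3
  refine Nat.eq_of_mul_eq_mul_right hM3 ?_
  have hn' : n - 1 + 3 = n + 2 := by omega
  rw [← pow_add, hn', ← h]
  congr 2
  refine Finset.filter_congr fun ω _ => ?_
  simp only [InBucket, h3]

/-- **Claim 5.16, summed over the useful `Z`-blocks and the seeds of the bucket** ("linearity of
expectation"): over the seeds putting `T ∈ 𝒯α` into bucket `b` (with `T` present),
`∑_ω |holes_ω T| ≤ U(T) · M^{n-1}` — each pair `(K̂, T')` contributes the `M^{n-1}` seeds putting both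
`T` and `T'` into bucket `b` (Claim 5.5, triples sharing `Z_K`). [cite: VassilevskaWilliamsXuXuZhou2024, Claim 5.16 and §5.6 ("linearity of expectation")] -/
theorem sum_card_holes_le (hD : D.WellFormed) (hM : M ≠ 2) (hcM : 2 * c < M) (hn : 0 < n)
    (hB : ThreeAPFree (D.B : Set (ZMod M)))
    {T : (Fin n → Fin (2 * c + 1)) × (Fin n → Fin (2 * c + 1)) × (Fin n → Fin (2 * c + 1))}
    (hT : T ∈ D.𝒯α) (b : ZMod M) :
    ∑ ω ∈ univ.filter (fun ω : VxxzSeed M n => InBucket (2 * c) ω T b ∧ T ∈ D.present ω), (D.holes ω T).card ≤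
      (D.holePairs T).card * M ^ (n - 1) := by
  have hT𝒯 : T ∈ D.tripleSet := hD.subset hT
  have step1 : ∀ ω : VxxzSeed M n, InBucket (2 * c) ω T b → T ∈ D.present ω →
      (D.holes ω T).card ≤ ((D.holePairs T).filter fun p => InBucket (2 * c) ω T b ∧ InBucket (2 * c) ω p.2 b).card := by
    intro ω hb hp
    refine Finset.card_le_card_of_surjOn Prod.fst fun Kh hKh => ?_
    obtain ⟨T', hp', hb'⟩ := hole_subset hM hB hp (mem_coe.1 hKh)
    refine ⟨(Kh, T'), mem_coe.2 (mem_filter.2 ⟨hp', hb, ?_⟩), rfl⟩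
    rwa [hb.1] at hb'
  calc ∑ ω ∈ univ.filter (fun ω : VxxzSeed M n => InBucket (2 * c) ω T b ∧ T ∈ D.present ω), (D.holes ω T).card
      ≤ ∑ ω ∈ univ.filter (fun ω : VxxzSeed M n => InBucket (2 * c) ω T b ∧ T ∈ D.present ω),
          ((D.holePairs T).filter fun p => InBucket (2 * c) ω T b ∧ InBucket (2 * c) ω p.2 b).card :=
        sum_le_sum fun ω hω => step1 ω (mem_filter.1 hω).2.1 (mem_filter.1 hω).2.2
    _ ≤ ∑ ω : VxxzSeed M n, ((D.holePairs T).filter fun p => InBucket (2 * c) ω T b ∧ InBucket (2 * c) ω p.2 b).card :=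
        sum_le_sum_of_subset_of_nonneg (filter_subset _ _) fun _ _ _ => Nat.zero_le _
    _ = ∑ p ∈ D.holePairs T, (univ.filter fun ω : VxxzSeed M n => InBucket (2 * c) ω T b ∧ InBucket (2 * c) ω p.2 b).card := by
        simp only [card_filter]
        rw [sum_comm]
    _ = ∑ _p ∈ D.holePairs T, M ^ (n - 1) := by
        refine sum_congr rfl fun p hp => ?_
        obtain ⟨hp𝒯, -, -, hne, h3, -⟩ := mem_filter.1 hp
        exact card_seeds_inBucket_shareZ hM hcM hn hT𝒯 (hD.subset (mem_product.1 hp𝒯).2) hne h3 b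
    _ = (D.holePairs T).card * M ^ (n - 1) := by rw [sum_const, smul_eq_mul]

/-- **Markov's inequality**: at most `U(T) M^{n-1} / h` seeds of the bucket give more than `h` holes.
[cite: VassilevskaWilliamsXuXuZhou2024, §5.6 ("linearity of expectation and Markov's inequality")] -/
theorem card_seeds_manyHoles_mul_le (hD : D.WellFormed) (hM : M ≠ 2) (hcM : 2 * c < M) (hn : 0 < n)
    (hB : ThreeAPFree (D.B : Set (ZMod M)))
    {T : (Fin n → Fin (2 * c + 1)) × (Fin n → Fin (2 * c + 1)) × (Fin n → Fin (2 * c + 1))}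
    (hT : T ∈ D.𝒯α) (b : ZMod M) (h : ℕ) :
    (univ.filter fun ω : VxxzSeed M n =>
        InBucket (2 * c) ω T b ∧ T ∈ D.present ω ∧ h < (D.holes ω T).card).card * h ≤
      (D.holePairs T).card * M ^ (n - 1) := by
  calc (univ.filter fun ω : VxxzSeed M n =>
          InBucket (2 * c) ω T b ∧ T ∈ D.present ω ∧ h < (D.holes ω T).card).card * h
      = ∑ _ω ∈ univ.filter (fun ω : VxxzSeed M n =>
          InBucket (2 * c) ω T b ∧ T ∈ D.present ω ∧ h < (D.holes ω T).card), h := by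
        rw [sum_const, smul_eq_mul]
    _ ≤ ∑ ω ∈ univ.filter (fun ω : VxxzSeed M n =>
          InBucket (2 * c) ω T b ∧ T ∈ D.present ω ∧ h < (D.holes ω T).card), (D.holes ω T).card :=
        sum_le_sum fun ω hω => ((mem_filter.1 hω).2.2.2).le
    _ ≤ ∑ ω ∈ univ.filter (fun ω : VxxzSeed M n => InBucket (2 * c) ω T b ∧ T ∈ D.present ω), (D.holes ω T).card := by
        refine sum_le_sum_of_subset_of_nonneg (fun ω hω => ?_) fun _ _ _ => Nat.zero_le _
        have h' := mem_filter.1 hω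
        exact mem_filter.2 ⟨h'.1, h'.2.1, h'.2.2.1⟩
    _ ≤ (D.holePairs T).card * M ^ (n - 1) := sum_card_holes_le hD hM hcM hn hB hT b

/-- **The good seeds of a bucket** (Claim 5.6 + Markov, §5.6: "with constant probability, the
subtensor … is a copy of `𝒯*` whose fraction of holes does not exceed `1/8N`"): under the cleanup
requirement `8|𝒯| ≤ M |typeClass μX|, 8|𝒯| ≤ M |typeClass μY|` and the final constraint
`10 · U(T) · M^{n-1} ≤ h · M^n` (with `h = M_Z/(8N)` this is `M ≥ 80 N U(T)/M_Z`, the printed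
`M₀ ≥ (numalpha p_comp/numzblock) · 80N`), at least half of the `M^n` seeds putting `T ∈ 𝒯α` into the
bucket `b ∈ B` make `T` present with at most `h` holes. [cite: VassilevskaWilliamsXuXuZhou2024, §5.6 (the final constraint on M₀ and the union-bound paragraph)] -/
theorem card_seeds_good_ge (hD : D.WellFormed) (hM : M ≠ 2) (hcM : 2 * c < M) (hn : 0 < n)
    (hB : ThreeAPFree (D.B : Set (ZMod M)))
    (h8X : 8 * D.tripleSet.card ≤ M * (typeClass n D.μX).card)
    (h8Y : 8 * D.tripleSet.card ≤ M * (typeClass n D.μY).card)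
    {T : (Fin n → Fin (2 * c + 1)) × (Fin n → Fin (2 * c + 1)) × (Fin n → Fin (2 * c + 1))}
    (hT : T ∈ D.𝒯α) {b : ZMod M} (hb : b ∈ D.B) {h : ℕ} (hh : 0 < h)
    (hU : 10 * ((D.holePairs T).card * M ^ (n - 1)) ≤ h * M ^ n) :
    M ^ n ≤ 2 * (univ.filter fun ω : VxxzSeed M n =>
      T ∈ D.present ω ∧ InBucket (2 * c) ω T b ∧ (D.holes ω T).card ≤ h).card := by
  have hT𝒯 : T ∈ D.tripleSet := hD.subset hT
  -- Claim 5.6: the survivors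
  have h56 := vxxz2024_claim56 hM hcM hn h8X h8Y hT𝒯 b
  set Sv := univ.filter fun ω : VxxzSeed M n => Survives D.tripleSet ω T b with hSv
  set good := univ.filter fun ω : VxxzSeed M n =>
    T ∈ D.present ω ∧ InBucket (2 * c) ω T b ∧ (D.holes ω T).card ≤ h with hgood
  set bad := univ.filter fun ω : VxxzSeed M n =>
    InBucket (2 * c) ω T b ∧ T ∈ D.present ω ∧ h < (D.holes ω T).card with hbad
  -- survivors are present (the bucket is in `B`) and either good or bad
  have hcover : Sv ⊆ good ∪ bad := by
    intro ω hω
    rw [hSv, mem_filter] at hω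
    have hpres : T ∈ D.present ω := by
      rw [present, presentTriples_eq_filter_survives hM hD.subset ω hB, mem_filter]
      exact ⟨hT, b, hb, hω.2⟩
    have hin : InBucket (2 * c) ω T b := hω.2.1
    rw [mem_union, hgood, hbad, mem_filter, mem_filter]
    by_cases hle : (D.holes ω T).card ≤ h
    · exact Or.inl ⟨mem_univ _, hpres, hin, hle⟩
    · exact Or.inr ⟨mem_univ _, hin, hpres, Nat.lt_of_not_le hle⟩
  have hSv_le : Sv.card ≤ good.card + bad.card := (card_le_card hcover).trans (card_union_le _ _)
  -- Markov: `10 |bad| ≤ M^n`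
  have hbad_le : 10 * bad.card ≤ M ^ n := by
    have hm := card_seeds_manyHoles_mul_le hD hM hcM hn hB hT b h
    have : 10 * bad.card * h ≤ h * M ^ n := by
      calc 10 * bad.card * h = 10 * (bad.card * h) := by ring
        _ ≤ 10 * ((D.holePairs T).card * M ^ (n - 1)) := Nat.mul_le_mul_left _ hm
        _ ≤ h * M ^ n := hU
    rw [mul_comm h] at this
    exact Nat.le_of_mul_le_mul_right this hh
  omega

/-- For a fixed seed, the good pairs `(b, T)`, `b ∈ B`, are counted by the good triples (the bucket of
a present triple is `h_X(I) ∈ B`). [cite: VassilevskaWilliamsXuXuZhou2024, §5.2 (buckets)] -/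
theorem card_filter_product_good_eq (hM : M ≠ 2) (hB : ThreeAPFree (D.B : Set (ZMod M)))
    (hsub : D.𝒯α ⊆ D.tripleSet) (ω : VxxzSeed M n) (h : ℕ) :
    ((D.B ×ˢ D.𝒯α).filter fun bT => bT.2 ∈ D.present ω ∧ InBucket (2 * c) ω bT.2 bT.1 ∧
        (D.holes ω bT.2).card ≤ h).card =
      ((D.present ω).filter fun T => (D.holes ω T).card ≤ h).card := by
  refine card_bij (fun bT _ => bT.2) (fun bT hbT => ?_) (fun bT₁ h₁ bT₂ h₂ heq => ?_) (fun T hT => ?_)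
  · rw [mem_filter] at hbT
    exact mem_filter.2 ⟨hbT.2.1, hbT.2.2.2⟩
  · rw [mem_filter] at h₁ h₂
    have e : bT₁.1 = bT₂.1 := by
      have e1 := h₁.2.2.1.1
      have e2 := h₂.2.2.1.1
      rw [heq] at e1
      exact e1.symm.trans e2
    exact Prod.ext e heq
  · rw [mem_filter] at hT
    obtain ⟨hTp, hle⟩ := hT
    have hTα : T ∈ D.𝒯α := presentTriples_subset hTp
    have hsurv : ∃ b ∈ D.B, Survives D.tripleSet ω T b := by
      have := hTp
      rw [present, presentTriples_eq_filter_survives hM hsub ω hB, mem_filter] at this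
      exact this.2
    obtain ⟨b, hb, hs⟩ := hsurv
    exact ⟨(b, T), mem_filter.2 ⟨mem_product.2 ⟨hb, hTα⟩, hTp, hs.1, hle⟩, rfl⟩

/-- **Existence of a good seed** (§5.6: "`𝒯'''` contains `numalpha · M^{-1-o(1)}` copies of `𝒯*` whose
fraction of holes is `1/8N`", in exact form): under the hypotheses of `card_seeds_good_ge` for every
`T ∈ 𝒯α`, some seed `ω` makes at least `|B| · |𝒯α| / (2 M²)` triples present with at most `h` holes
each: `|B| |𝒯α| ≤ 2 M² · #{T ∈ 𝒯'(ω) | |holes_ω T| ≤ h}`. [cite: VassilevskaWilliamsXuXuZhou2024, §5.6] -/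
theorem exists_seed_many_good_copies (hD : D.WellFormed) (hM : M ≠ 2) (hcM : 2 * c < M) (hn : 0 < n)
    (hB : ThreeAPFree (D.B : Set (ZMod M)))
    (h8X : 8 * D.tripleSet.card ≤ M * (typeClass n D.μX).card)
    (h8Y : 8 * D.tripleSet.card ≤ M * (typeClass n D.μY).card) {h : ℕ} (hh : 0 < h)
    (hU : ∀ T ∈ D.𝒯α, 10 * ((D.holePairs T).card * M ^ (n - 1)) ≤ h * M ^ n) :
    ∃ ω : VxxzSeed M n, D.B.card * D.𝒯α.card ≤
      2 * M ^ 2 * ((D.present ω).filter fun T => (D.holes ω T).card ≤ h).card := by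
  -- the total number of good (seed, bucket, triple) incidences
  have hsum : D.B.card * D.𝒯α.card * M ^ n ≤ 2 * ∑ ω : VxxzSeed M n,
      ((D.present ω).filter fun T => (D.holes ω T).card ≤ h).card := by
    have hswap : ∑ ω : VxxzSeed M n, ((D.B ×ˢ D.𝒯α).filter fun bT =>
        bT.2 ∈ D.present ω ∧ InBucket (2 * c) ω bT.2 bT.1 ∧ (D.holes ω bT.2).card ≤ h).card =
        ∑ bT ∈ D.B ×ˢ D.𝒯α, (univ.filter fun ω : VxxzSeed M n =>
          bT.2 ∈ D.present ω ∧ InBucket (2 * c) ω bT.2 bT.1 ∧ (D.holes ω bT.2).card ≤ h).card := by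
      simp only [card_filter]
      rw [sum_comm]
    calc D.B.card * D.𝒯α.card * M ^ n = ∑ _bT ∈ D.B ×ˢ D.𝒯α, M ^ n := by
          rw [sum_const, card_product, smul_eq_mul]
      _ ≤ ∑ bT ∈ D.B ×ˢ D.𝒯α, 2 * (univ.filter fun ω : VxxzSeed M n =>
            bT.2 ∈ D.present ω ∧ InBucket (2 * c) ω bT.2 bT.1 ∧ (D.holes ω bT.2).card ≤ h).card :=
          sum_le_sum fun bT hbT => card_seeds_good_ge hD hM hcM hn hB h8X h8Y (mem_product.1 hbT).2
            (mem_product.1 hbT).1 hh (hU _ (mem_product.1 hbT).2)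
      _ = 2 * ∑ ω : VxxzSeed M n, ((D.present ω).filter fun T => (D.holes ω T).card ≤ h).card := by
          rw [← mul_sum, ← hswap]
          congr 1
          exact sum_congr rfl fun ω _ => card_filter_product_good_eq hM hB hD.subset ω h
  -- averaging over the `M^{n+2}` seeds
  by_contra hcon
  simp only [not_exists, not_le] at hcon
  have hlt : ∑ ω : VxxzSeed M n, 2 * M ^ 2 * ((D.present ω).filter fun T => (D.holes ω T).card ≤ h).card <
      ∑ _ω : VxxzSeed M n, D.B.card * D.𝒯α.card :=
    sum_lt_sum_of_nonempty univ_nonempty fun ω _ => hcon ω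
  rw [sum_const, card_univ, card_vxxzSeed, smul_eq_mul, ← mul_sum] at hlt
  have : M ^ (n + 2) * (D.B.card * D.𝒯α.card) ≤
      2 * M ^ 2 * ∑ ω : VxxzSeed M n, ((D.present ω).filter fun T => (D.holes ω T).card ≤ h).card := by
    calc M ^ (n + 2) * (D.B.card * D.𝒯α.card) = M ^ 2 * (D.B.card * D.𝒯α.card * M ^ n) := by ring
      _ ≤ M ^ 2 * (2 * ∑ ω : VxxzSeed M n, ((D.present ω).filter fun T => (D.holes ω T).card ≤ h).card) :=
          Nat.mul_le_mul_left _ hsum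
      _ = _ := by ring
  exact absurd (lt_of_le_of_lt this hlt) (lt_irrefl _)

/-! ### The same with the Markov threshold `h + 1` (covering `h = 0`: "no hole at all") -/

/-- **Markov's inequality, threshold `h+1`**: at most `U(T) M^{n-1} / (h+1)` seeds of the bucket give
more than `h` holes. [cite: VassilevskaWilliamsXuXuZhou2024, §5.6 ("linearity of expectation and Markov's inequality")] -/
theorem card_seeds_manyHoles_mul_succ_le (hD : D.WellFormed) (hM : M ≠ 2) (hcM : 2 * c < M) (hn : 0 < n)
    (hB : ThreeAPFree (D.B : Set (ZMod M)))
    {T : (Fin n → Fin (2 * c + 1)) × (Fin n → Fin (2 * c + 1)) × (Fin n → Fin (2 * c + 1))}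
    (hT : T ∈ D.𝒯α) (b : ZMod M) (h : ℕ) :
    (univ.filter fun ω : VxxzSeed M n =>
        InBucket (2 * c) ω T b ∧ T ∈ D.present ω ∧ h < (D.holes ω T).card).card * (h + 1) ≤
      (D.holePairs T).card * M ^ (n - 1) := by
  calc (univ.filter fun ω : VxxzSeed M n =>
          InBucket (2 * c) ω T b ∧ T ∈ D.present ω ∧ h < (D.holes ω T).card).card * (h + 1)
      = ∑ _ω ∈ univ.filter (fun ω : VxxzSeed M n =>
          InBucket (2 * c) ω T b ∧ T ∈ D.present ω ∧ h < (D.holes ω T).card), (h + 1) := by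
        rw [sum_const, smul_eq_mul]
    _ ≤ ∑ ω ∈ univ.filter (fun ω : VxxzSeed M n =>
          InBucket (2 * c) ω T b ∧ T ∈ D.present ω ∧ h < (D.holes ω T).card), (D.holes ω T).card :=
        sum_le_sum fun ω hω => Nat.succ_le_of_lt (mem_filter.1 hω).2.2.2
    _ ≤ ∑ ω ∈ univ.filter (fun ω : VxxzSeed M n => InBucket (2 * c) ω T b ∧ T ∈ D.present ω), (D.holes ω T).card := by
        refine sum_le_sum_of_subset_of_nonneg (fun ω hω => ?_) fun _ _ _ => Nat.zero_le _
        have h' := mem_filter.1 hω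
        exact mem_filter.2 ⟨h'.1, h'.2.1, h'.2.2.1⟩
    _ ≤ (D.holePairs T).card * M ^ (n - 1) := sum_card_holes_le hD hM hcM hn hB hT b

/-- **The good seeds of a bucket, threshold `h+1`**: under `10 · U(T) · M^{n-1} ≤ (h+1) · M^n` (no
positivity assumption on `h`; `h = 0` is "no hole with probability `≥ 9/10`"), at least half of the
`M^n` seeds putting `T ∈ 𝒯α` into the bucket `b ∈ B` make `T` present with at most `h` holes.
[cite: VassilevskaWilliamsXuXuZhou2024, §5.6 (the final constraint on M₀ and the union-bound paragraph)] -/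
theorem card_seeds_good_ge' (hD : D.WellFormed) (hM : M ≠ 2) (hcM : 2 * c < M) (hn : 0 < n)
    (hB : ThreeAPFree (D.B : Set (ZMod M)))
    (h8X : 8 * D.tripleSet.card ≤ M * (typeClass n D.μX).card)
    (h8Y : 8 * D.tripleSet.card ≤ M * (typeClass n D.μY).card)
    {T : (Fin n → Fin (2 * c + 1)) × (Fin n → Fin (2 * c + 1)) × (Fin n → Fin (2 * c + 1))}
    (hT : T ∈ D.𝒯α) {b : ZMod M} (hb : b ∈ D.B) {h : ℕ}
    (hU : 10 * ((D.holePairs T).card * M ^ (n - 1)) ≤ (h + 1) * M ^ n) :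
    M ^ n ≤ 2 * (univ.filter fun ω : VxxzSeed M n =>
      T ∈ D.present ω ∧ InBucket (2 * c) ω T b ∧ (D.holes ω T).card ≤ h).card := by
  have hT𝒯 : T ∈ D.tripleSet := hD.subset hT
  have h56 := vxxz2024_claim56 hM hcM hn h8X h8Y hT𝒯 b
  set Sv := univ.filter fun ω : VxxzSeed M n => Survives D.tripleSet ω T b with hSv
  set good := univ.filter fun ω : VxxzSeed M n =>
    T ∈ D.present ω ∧ InBucket (2 * c) ω T b ∧ (D.holes ω T).card ≤ h with hgood
  set bad := univ.filter fun ω : VxxzSeed M n =>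
    InBucket (2 * c) ω T b ∧ T ∈ D.present ω ∧ h < (D.holes ω T).card with hbad
  have hcover : Sv ⊆ good ∪ bad := by
    intro ω hω
    rw [hSv, mem_filter] at hω
    have hpres : T ∈ D.present ω := by
      rw [present, presentTriples_eq_filter_survives hM hD.subset ω hB, mem_filter]
      exact ⟨hT, b, hb, hω.2⟩
    have hin : InBucket (2 * c) ω T b := hω.2.1
    rw [mem_union, hgood, hbad, mem_filter, mem_filter]
    by_cases hle : (D.holes ω T).card ≤ h
    · exact Or.inl ⟨mem_univ _, hpres, hin, hle⟩
    · exact Or.inr ⟨mem_univ _, hin, hpres, Nat.lt_of_not_le hle⟩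
  have hSv_le : Sv.card ≤ good.card + bad.card := (card_le_card hcover).trans (card_union_le _ _)
  have hbad_le : 10 * bad.card ≤ M ^ n := by
    have hm := card_seeds_manyHoles_mul_succ_le hD hM hcM hn hB hT b h
    have : 10 * bad.card * (h + 1) ≤ (h + 1) * M ^ n := by
      calc 10 * bad.card * (h + 1) = 10 * (bad.card * (h + 1)) := by ring
        _ ≤ 10 * ((D.holePairs T).card * M ^ (n - 1)) := Nat.mul_le_mul_left _ hm
        _ ≤ (h + 1) * M ^ n := hU
    rw [mul_comm (h + 1)] at this
    exact Nat.le_of_mul_le_mul_right this (Nat.succ_pos h)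
  omega

/-- **Existence of a good seed, threshold `h+1`** (as `exists_seed_many_good_copies`, without the
positivity assumption on `h`). [cite: VassilevskaWilliamsXuXuZhou2024, §5.6] -/
theorem exists_seed_many_good_copies' (hD : D.WellFormed) (hM : M ≠ 2) (hcM : 2 * c < M) (hn : 0 < n)
    (hB : ThreeAPFree (D.B : Set (ZMod M)))
    (h8X : 8 * D.tripleSet.card ≤ M * (typeClass n D.μX).card)
    (h8Y : 8 * D.tripleSet.card ≤ M * (typeClass n D.μY).card) {h : ℕ}
    (hU : ∀ T ∈ D.𝒯α, 10 * ((D.holePairs T).card * M ^ (n - 1)) ≤ (h + 1) * M ^ n) :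
    ∃ ω : VxxzSeed M n, D.B.card * D.𝒯α.card ≤
      2 * M ^ 2 * ((D.present ω).filter fun T => (D.holes ω T).card ≤ h).card := by
  have hsum : D.B.card * D.𝒯α.card * M ^ n ≤ 2 * ∑ ω : VxxzSeed M n,
      ((D.present ω).filter fun T => (D.holes ω T).card ≤ h).card := by
    have hswap : ∑ ω : VxxzSeed M n, ((D.B ×ˢ D.𝒯α).filter fun bT =>
        bT.2 ∈ D.present ω ∧ InBucket (2 * c) ω bT.2 bT.1 ∧ (D.holes ω bT.2).card ≤ h).card =
        ∑ bT ∈ D.B ×ˢ D.𝒯α, (univ.filter fun ω : VxxzSeed M n =>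
          bT.2 ∈ D.present ω ∧ InBucket (2 * c) ω bT.2 bT.1 ∧ (D.holes ω bT.2).card ≤ h).card := by
      simp only [card_filter]
      rw [sum_comm]
    calc D.B.card * D.𝒯α.card * M ^ n = ∑ _bT ∈ D.B ×ˢ D.𝒯α, M ^ n := by
          rw [sum_const, card_product, smul_eq_mul]
      _ ≤ ∑ bT ∈ D.B ×ˢ D.𝒯α, 2 * (univ.filter fun ω : VxxzSeed M n =>
            bT.2 ∈ D.present ω ∧ InBucket (2 * c) ω bT.2 bT.1 ∧ (D.holes ω bT.2).card ≤ h).card :=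
          sum_le_sum fun bT hbT => card_seeds_good_ge' hD hM hcM hn hB h8X h8Y (mem_product.1 hbT).2
            (mem_product.1 hbT).1 (hU _ (mem_product.1 hbT).2)
      _ = 2 * ∑ ω : VxxzSeed M n, ((D.present ω).filter fun T => (D.holes ω T).card ≤ h).card := by
          rw [← mul_sum, ← hswap]
          congr 1
          exact sum_congr rfl fun ω _ => card_filter_product_good_eq hM hB hD.subset ω h
  by_contra hcon
  simp only [not_exists, not_le] at hcon
  have hlt : ∑ ω : VxxzSeed M n, 2 * M ^ 2 * ((D.present ω).filter fun T => (D.holes ω T).card ≤ h).card <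
      ∑ _ω : VxxzSeed M n, D.B.card * D.𝒯α.card :=
    sum_lt_sum_of_nonempty univ_nonempty fun ω _ => hcon ω
  rw [sum_const, card_univ, card_vxxzSeed, smul_eq_mul, ← mul_sum] at hlt
  have : M ^ (n + 2) * (D.B.card * D.𝒯α.card) ≤
      2 * M ^ 2 * ∑ ω : VxxzSeed M n, ((D.present ω).filter fun T => (D.holes ω T).card ≤ h).card := by
    calc M ^ (n + 2) * (D.B.card * D.𝒯α.card) = M ^ 2 * (D.B.card * D.𝒯α.card * M ^ n) := by ring
      _ ≤ M ^ 2 * (2 * ∑ ω : VxxzSeed M n, ((D.present ω).filter fun T => (D.holes ω T).card ≤ h).card) :=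
          Nat.mul_le_mul_left _ hsum
      _ = _ := by ring
  exact absurd (lt_of_le_of_lt this hlt) (lt_irrefl _)

end GlobalStageData

end Literature.Computability.AlgebraicComplexity
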